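import Literature.NumberTheory.GaloisCohomology.KummerClassLocalPower
import Literature.NumberTheory.GaloisCohomology.LocalInvariantOfUnramifiedClass
import HarnessLib

/-!
# Crux `PrintCf2.SplitBadTwoRankOneOfFacts` (stmt-BirchSwinnertonDyer-20368), S3n′-FACT-FREE road, brick R1′ (second half, θ = 1):
# THE KUMMER DICTIONARY AT `ū ∣ v̄` — a Kummer class ORTHOGONAL TO THE UNRAMIFIED CHARACTERS has valuation divisible by `n`

Cell `bsd-print-cf2`, WIDTH seat `bsd-line-cf2-p1-w7` g6 (prover-bsd-line-cf2-p1-w7-g6-0); `--supports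
stmt-BirchSwinnertonDyer-20368` (helper, Theses-free). HONEST FRAMING: nothing here closes the crux or a registered stub;
BSD is not proved by any of this; no summit statement is proved by this seat. No definition, no named fact, no `sorry`.
UNCONDITIONAL.

WHAT (memo `Cruxes/SplitBadTwoRankOneOfFacts/S3N-FACTFREE-w2g14.md` §3 / §6 Remark / §7, piece (K-ū) of the Kummer dictionary
asked for by `-w2` g14, 2026-08-29T05:07:37Z; companion of `…KummerUnramifiedValuation` = piece (K-ur), p699384). At the place
`ū ∣ v̄ ∣ p` of the layer `F = K*_n` the dual Selmer condition of (PRO-NULL) is «orthogonal to the UNRAMIFIED classes under the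
local Tate pairing»; for Kummer classes this is «`n ∣ v_ū(x)`». In the tree's local currency (non-archimedean local field `F`
of characteristic `0`; `κ_n(x) = δ₀(x) ∈ H¹(Γ_F, μ_n)` the Kummer class of the Kummer sequence `isSES_kummer`; `[θ]` the class
of the crossed homomorphism `σ ↦ θ(σ)·id ∈ μ_n^∨(1)` of a character `θ : Γ_F → ℤ/n`, `Prop121vii.scalarCocycle`; `∪` the
cup product of the evaluation pairing `(mu F n).tateDualPairing n`; `ord F` the normalised valuation):

* §0 `δ₀_baseUnitsInvariant_eq_toAdd_kummerMap` — **the tree's two Kummer classes agree**: `δ₀(x) = kummerMap F n x` (any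
  field; the connecting homomorphism of `0 → μ_n → F̄ˣ → F̄ˣ → 0` versus the explicit cocycle `σ ↦ σ(ⁿ√x)/ⁿ√x` of
  `GaloisCohomologyKummerProofs`) — the bridge between the dialect of p697446 / (K-ur) and the dialect of the local
  class-field-theory files;
* §1 `cupProduct_δ₀_scalarCocycle_eq_zero_iff_dvd_ord` — **`κ_n(x) ∪ [χ] = 0 ⟺ (n : ℤ) ∣ ord x`** for the normalised
  unramified character `χ` (`χ(I_F) = 0`, `χ(Frob) = 1`): `inv_n(κ_n(x) ∪ χ) = ord x` (`invLevel_cupProduct_δ₀`) and `inv_n`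
  is bijective; `dvd_ord_of_forall_unramified_cupProduct_eq_zero` / `cupProduct_δ₀_scalarCocycle_eq_zero_of_dvd_ord` — the
  same with ALL unramified `θ` (**the annihilator of the unramified characters among the Kummer classes is exactly
  `{κ_n(x) : n ∣ ord x}`**, `forall_unramified_cupProduct_eq_zero_iff_dvd_ord`);
* §2 the completion `F_w` of a number field: `dvd_log_valued_of_dvd_ord` (`(n:ℤ) ∣ ord_{F_w} y → (n:ℤ) ∣ log (Valued.v y)`,
  Mathlib's `ℤᵐ⁰`-valuation), and **(K-ū)** `dvd_log_valuation_of_forall_unramified_cupProduct_eq_zero`: for `a ∈ F^×`, if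
  the local Kummer class `κ_n(a) ∈ H¹(Γ_{F_w}, μ_n(F̄_w))` is orthogonal to every unramified character of `Γ_{F_w}`, then
  `(n : ℤ) ∣ log (w.valuation F a)`; plus the dictionary `cohomologyMap_muLocalIso_localization_kummerMap`: the Poitou–Tate
  localisation `loc_w (kummerMap F n a)` IS, along `μ_n(F̄)|_{Γ_{F_w}} ≅ μ_n(F̄_w)` (`muLocalIso`), the local class
  `kummerMap F_w n a` — so a consumer holding the orthogonality in the `LocalInvariants.canonical` dialect
  (`localInvariantMap = invLevel ∘ H²(muLocalIso)`, `localInvariantMap_apply`) reaches §2 by one rewrite.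
beyond-print theorem: no (Serre *Local Fields* XIV §1 Prop. 3 / XIII §4 Prop. 13). presearch: NOTES.md.

References: J.-P. Serre, *Local Fields* (1979), XIII §4 Prop. 13, XIV §1 Prop. 3 (`(χ, b)_v = v(b)·χ(Frob)` for
unramified `χ`), X §3 (Kummer); J.-P. Serre, *Galois Cohomology* (1997), II §1.2 (Kummer sequence, connecting map);
J. S. Milne, *Arithmetic Duality Theorems* (2006), I §2 (local Tate duality; unramified classes).
-/

noncomputable section

set_option linter.dupNamespace false
set_option autoImplicit false

open scoped Classical WithZero
open NumberField IsDedekindDomain Field ValuativeRel Function CategoryTheory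
open _root_.ContinuousCohomology
open Literature.NumberTheory.GaloisRepresentations
open Literature.NumberTheory.GaloisRepresentations.DiscreteGaloisModule
open Literature.NumberTheory.GaloisRepresentations.LocalWeilDatum
open Literature.NumberTheory.GaloisRepresentations.IsNonarchimedeanLocalField
open Literature.NumberTheory.GaloisCohomology
open Literature.AnabelianGeometry.AbsoluteAnabelian
open Literature.AnabelianGeometry.AbsoluteAnabelian.Prop121vii

universe u

namespace Summit.BirchSwinnertonDyer.BirchSwinnertonDyer.Theorems.PrintCf2.KummerProNull

/-! ### §0 The two Kummer classes of the tree agree -/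

section Bridge

variable (F : Type u) [Field F] (n : ℕ) [NeZero n] [NeZero (n : F)]

/-- **`δ₀(x) = kummerMap F n x`.** The connecting homomorphism `δ₀ : (F̄ˣ)^{Γ_F} → H¹(Γ_F, μ_n)` of the Kummer sequence
`0 → μ_n → F̄ˣ →ⁿ F̄ˣ → 0` (`isSES_kummer`, `IsSES.δ₀`: `v ↦ [σ ↦ ι⁻¹(σ w − w)]` for any lift `w` of `v`) evaluated on
`x ∈ F^×` (`baseUnitsInvariant`) is the class of the explicit Kummer cocycle `σ ↦ σ(ⁿ√x)/ⁿ√x` (`kummerMap`,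
`GaloisCohomologyKummerProofs`): take the lift `w = ⁿ√x` (`kummerUnitsRoot`). [cite: SerreGaloisCohomology1997, II §1.2] -/
theorem δ₀_baseUnitsInvariant_eq_toAdd_kummerMap (x : F) (hx : x ≠ 0) :
    (isSES_kummer F n (NeZero.pos n)).δ₀ (baseUnitsInvariant F x hx) =
      Multiplicative.toAdd (kummerMap F n (Units.mk0 x hx)) := by
  set a : Fˣ := Units.mk0 x hx with ha
  set α : kummerUnits F n := kummerUnitsRoot F n a with hα
  set w : UnitsCarrier F := UnitsCarrier.ofUnits (α : (AlgebraicClosure F)ˣ) with hw_def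
  have hw : (kummerπ F n).hom w = (baseUnitsInvariant F x hx : UnitsCarrier F) := by
    apply unitsVal_injective F
    rw [kummerπ_hom_apply, unitsVal_zsmul, zpow_natCast, hw_def, unitsVal_ofUnits, hα, kummerUnitsRoot_pow]
    ext
    rw [Units.coe_map, MonoidHom.coe_coe, coe_unitsVal_baseUnitsInvariant, ha, Units.val_mk0]
  rw [(isSES_kummer F n (NeZero.pos n)).δ₀_apply_eq _ w hw]
  change _ = oneCocycleClass (mu F n).toTopRep (kummerOneCocycle F n α)
  congr 1
  refine Subtype.ext (ContinuousMap.ext fun σ => muVal_injective F n ?_)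
  have h1 := congrArg (unitsVal F) ((isSES_kummer F n (NeZero.pos n)).f_δ₀Cocycle_apply w
    (by rw [hw]; exact (baseUnitsInvariant F x hx).2) σ)
  rw [unitsVal_kummerι] at h1
  rw [h1, kummerOneCocycle_apply, muVal_kummerOneCocycleFun]
  rfl

end Bridge

/-! ### §1 The local core: `κ_n(x) ∪ [θ] = 0` for the unramified `θ` iff `n ∣ ord x` -/

section Local

variable (F : Type u) [Field F] [ValuativeRel F] [TopologicalSpace F] [IsNonarchimedeanLocalField F]
  [CharZero F] {n : ℕ} [NeZero n]

/-- **`κ_n(x) ∪ [χ] = 0 ⟺ (n : ℤ) ∣ ord_F(x)`** for the normalised unramified character `χ : Γ_F → ℤ/n` (`χ(I_F) = 0`,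
`χ(Frob) = 1`) and `x ∈ F^×`: THE residue map `inv_n : H²(Γ_F, μ_n) ⥲ ℤ/n` is bijective and `inv_n(κ_n(x) ∪ χ) = ord x`
(`invLevel_cupProduct_δ₀`, Serre XIV §1 Prop. 3). [cite: SerreLocalFields1979, XIV §1 Prop. 3] -/
theorem cupProduct_δ₀_scalarCocycle_eq_zero_iff_dvd_ord (χ : CyclicCharacter (absoluteGaloisGroup F) n)
    (hI : ∀ σ ∈ absInertia F, χ σ = 0) (hF : ∀ σ : absoluteGaloisGroup F, IsFrobPow σ 1 → χ σ = 1)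
    (x : F) (hx : x ≠ 0) :
    haveI : CompactSpace (absoluteGaloisGroup F) := absoluteGaloisGroup_compactSpace F
    ((mu F n).tateDualPairing n).cupProduct
        ((isSES_kummer F n (NeZero.pos n)).δ₀ (baseUnitsInvariant F x hx))
        (oneCocycleClass _ (scalarCocycle χ)) = 0 ↔ (n : ℤ) ∣ ord F x := by
  haveI : CompactSpace (absoluteGaloisGroup F) := absoluteGaloisGroup_compactSpace F
  have hval := invLevel_cupProduct_δ₀ F χ hI hF x hx
  rw [← ZMod.intCast_zmod_eq_zero_iff_dvd, ← hval, ← map_zero (invLevel F n)]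
  exact ((isInvariantMap_invLevel F n).1.1.eq_iff).symm

/-- **If `κ_n(x)` is orthogonal to every unramified character, then `(n : ℤ) ∣ ord_F(x)`** (`θ` ranges over the characters
`Γ_F → ℤ/n` killing the inertia group `I_F = absInertia F`; among them is the normalised one, `exists_normalizedCharacter`).
[cite: SerreLocalFields1979, XIV §1 Prop. 3] -/
theorem dvd_ord_of_forall_unramified_cupProduct_eq_zero (x : F) (hx : x ≠ 0)
    (h : haveI : CompactSpace (absoluteGaloisGroup F) := absoluteGaloisGroup_compactSpace F
      ∀ θ : CyclicCharacter (absoluteGaloisGroup F) n, (∀ σ ∈ absInertia F, θ σ = 0) →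
        ((mu F n).tateDualPairing n).cupProduct
          ((isSES_kummer F n (NeZero.pos n)).δ₀ (baseUnitsInvariant F x hx))
          (oneCocycleClass _ (scalarCocycle θ)) = 0) :
    (n : ℤ) ∣ ord F x := by
  rcases Nat.lt_or_ge 1 n with hn1 | hn1
  · obtain ⟨χ, hI, hF, -, -⟩ := exists_normalizedCharacter F n hn1
    exact (cupProduct_δ₀_scalarCocycle_eq_zero_iff_dvd_ord F χ hI hF x hx).mp (h χ hI)
  · have hn : n = 1 := le_antisymm hn1 (NeZero.pos n)
    subst hn
    exact ⟨ord F x, by rw [Nat.cast_one, one_mul]⟩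

/-- **Conversely, if `(n : ℤ) ∣ ord_F(x)` then `κ_n(x) ∪ [θ] = 0` for EVERY unramified `θ`**: `inv_n(κ_n(x) ∪ θ) =
ord(x) · θ(φ) = 0` (`invLevel_cupProduct_kummer_scalarCocycle_of_unramified`, `φ` a Frobenius lift) and `inv_n` is injective.
[cite: SerreLocalFields1979, XIII §4 Prop. 13; XIV §1 Prop. 3] -/
theorem cupProduct_δ₀_scalarCocycle_eq_zero_of_dvd_ord (x : F) (hx : x ≠ 0) (hdvd : (n : ℤ) ∣ ord F x)
    (θ : CyclicCharacter (absoluteGaloisGroup F) n) (hIθ : ∀ σ ∈ absInertia F, θ σ = 0) :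
    haveI : CompactSpace (absoluteGaloisGroup F) := absoluteGaloisGroup_compactSpace F
    ((mu F n).tateDualPairing n).cupProduct
        ((isSES_kummer F n (NeZero.pos n)).δ₀ (baseUnitsInvariant F x hx))
        (oneCocycleClass _ (scalarCocycle θ)) = 0 := by
  haveI : CompactSpace (absoluteGaloisGroup F) := absoluteGaloisGroup_compactSpace F
  obtain ⟨φ, hφ⟩ := exists_isAbsArithFrob_holds F
  have hφ1 : IsFrobPow φ 1 := IsAbsArithFrob.isFrobPow_holds hφ
  have hval := invLevel_cupProduct_kummer_scalarCocycle_of_unramified F θ hIθ hφ1 x hx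
  rw [(ZMod.intCast_zmod_eq_zero_iff_dvd _ n).mpr hdvd, zero_mul, ← map_zero (invLevel F n)] at hval
  exact (isInvariantMap_invLevel F n).1.1 hval

/-- **The annihilator of the unramified characters among the Kummer classes**: `κ_n(x) ∪ [θ] = 0` for all unramified `θ`
`⟺ (n : ℤ) ∣ ord_F(x)` — i.e. `(H¹_ur(F, ℤ/n))^⊥ ∩ κ_n(F^×) = κ_n({x : n ∣ ord x}) = κ_n(𝒪_F^× · F^{×n})` under the local
Tate pairing (the description of the dual local condition at `ū ∣ v̄` used by (PRO-NULL)). [cite: SerreLocalFields1979, XIV §1 Prop. 3]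
[cite: MilneADT2006, Ch. I §2 (Thm. 2.6)] -/
theorem forall_unramified_cupProduct_eq_zero_iff_dvd_ord (x : F) (hx : x ≠ 0) :
    haveI : CompactSpace (absoluteGaloisGroup F) := absoluteGaloisGroup_compactSpace F
    (∀ θ : CyclicCharacter (absoluteGaloisGroup F) n, (∀ σ ∈ absInertia F, θ σ = 0) →
        ((mu F n).tateDualPairing n).cupProduct
          ((isSES_kummer F n (NeZero.pos n)).δ₀ (baseUnitsInvariant F x hx))
          (oneCocycleClass _ (scalarCocycle θ)) = 0) ↔ (n : ℤ) ∣ ord F x :=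
  ⟨dvd_ord_of_forall_unramified_cupProduct_eq_zero F x hx,
    fun h θ hI => cupProduct_δ₀_scalarCocycle_eq_zero_of_dvd_ord F x hx h θ hI⟩

/-- The same annihilator statement in the `kummerMap` dialect (`n` invertible in `F`): for `a ∈ F^×`,
`kummerMap F n a ∪ [θ] = 0` for all unramified `θ` `⟺ (n : ℤ) ∣ ord_F(a)`. [cite: SerreLocalFields1979, XIV §1 Prop. 3] -/
theorem forall_unramified_cupProduct_kummerMap_eq_zero_iff_dvd_ord [NeZero (n : F)] (a : Fˣ) :
    haveI : CompactSpace (absoluteGaloisGroup F) := absoluteGaloisGroup_compactSpace F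
    (∀ θ : CyclicCharacter (absoluteGaloisGroup F) n, (∀ σ ∈ absInertia F, θ σ = 0) →
        ((mu F n).tateDualPairing n).cupProduct (Multiplicative.toAdd (kummerMap F n a))
          (oneCocycleClass _ (scalarCocycle θ)) = 0) ↔ (n : ℤ) ∣ ord F (a : F) := by
  have ha : Units.mk0 (a : F) a.ne_zero = a := Units.ext rfl
  rw [← forall_unramified_cupProduct_eq_zero_iff_dvd_ord F (a : F) a.ne_zero,
    δ₀_baseUnitsInvariant_eq_toAdd_kummerMap F n (a : F) a.ne_zero, ha]

end Local

/-! ### §2 The completion `F_w` of a number field: readout `(n : ℤ) ∣ log (w.valuation F a)` -/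

section Completion

variable (F : Type) [Field F] [NumberField F] (w : HeightOneSpectrum (𝓞 F)) {n : ℕ} [NeZero n]

omit [NeZero n] in
/-- **`n ∣ ord_{F_w}(y) ⟹ n ∣ log |y|_w`** for `y ∈ F_w^×`, `ord` the normalised valuation of the local field `F_w`
(`LocalWeilDatum.ord`, valuative relation) and `Valued.v : F_w → ℤᵐ⁰` Mathlib's adelic valuation (compatible with the
valuative relation, `AdicCompletionLocalField`): `|y| = |ϖ|^{ord y}` (`valuation_eq_unifValue_zpow_ord`) transported to
`Valued.v` (`Valuation.veq_iff_eq`) and `log` taken. [cite: NeukirchANT1999, Ch. II §5] -/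
theorem dvd_log_valued_of_dvd_ord {y : w.adicCompletion F} (hy : y ≠ 0)
    (h : (n : ℤ) ∣ ord (w.adicCompletion F) y) :
    (n : ℤ) ∣ WithZero.log (Valued.v y) := by
  obtain ⟨ϖ, hϖ⟩ := IsDiscreteValuationRing.exists_irreducible 𝒪[w.adicCompletion F]
  have hval : valuation (w.adicCompletion F) y =
      valuation (w.adicCompletion F) ((ϖ : w.adicCompletion F) ^ ord (w.adicCompletion F) y) := by
    rw [valuation_eq_unifValue_zpow_ord (w.adicCompletion F) hy, map_zpow₀,
      valuation_eq_unifValue_of_irreducible (w.adicCompletion F) hϖ]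
  have hv : Valued.v y = Valued.v ((ϖ : w.adicCompletion F) ^ ord (w.adicCompletion F) y) := by
    rw [← Valuation.veq_iff_eq (Valued.v : Valuation (w.adicCompletion F) ℤᵐ⁰),
      Valuation.veq_iff_eq (valuation (w.adicCompletion F))]
    exact hval
  obtain ⟨m, hm⟩ := h
  refine ⟨m * WithZero.log (Valued.v (ϖ : w.adicCompletion F)), ?_⟩
  rw [hv, map_zpow₀, WithZero.log_zpow, smul_eq_mul, hm, mul_assoc]

/-- **(K-ū) in the local dialect.** For a number field `F`, `n ≥ 1`, `a ∈ F^×` and a finite place `w`: if the Kummer class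
`κ_n(a) ∈ H¹(Γ_{F_w}, μ_n(F̄_w))` of `a` in the local field `F_w` is orthogonal, under the cup product of the evaluation
pairing, to every unramified character `θ : Γ_{F_w} → ℤ/n`, then `(n : ℤ) ∣ log (w.valuation F a)` — the dual local
condition «`⊥ H¹_ur`» at `ū ∣ v̄` forces the valuation hypothesis of p697446 at `ū`. [cite: SerreLocalFields1979, XIV §1 Prop. 3]
[cite: MilneADT2006, Ch. I §2 (Thm. 2.6)] -/
theorem dvd_log_valuation_of_forall_unramified_cupProduct_eq_zero (a : Fˣ)
    (h : haveI : CompactSpace (absoluteGaloisGroup (w.adicCompletion F)) :=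
        absoluteGaloisGroup_compactSpace (w.adicCompletion F)
      ∀ θ : CyclicCharacter (absoluteGaloisGroup (w.adicCompletion F)) n,
        (∀ σ ∈ absInertia (w.adicCompletion F), θ σ = 0) →
        ((mu (w.adicCompletion F) n).tateDualPairing n).cupProduct
          ((isSES_kummer (w.adicCompletion F) n (NeZero.pos n)).δ₀
            (baseUnitsInvariant (w.adicCompletion F) (algebraMap F (w.adicCompletion F) (a : F))
              ((map_ne_zero_iff _ (algebraMap F (w.adicCompletion F)).injective).2 a.ne_zero)))
          (oneCocycleClass _ (scalarCocycle θ)) = 0) :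
    (n : ℤ) ∣ WithZero.log (w.valuation F (a : F)) := by
  haveI : CharZero (w.adicCompletion F) := charZero_adicCompletion w
  have ha0 : algebraMap F (w.adicCompletion F) (a : F) ≠ 0 :=
    (map_ne_zero_iff _ (algebraMap F (w.adicCompletion F)).injective).2 a.ne_zero
  have hdvd := dvd_ord_of_forall_unramified_cupProduct_eq_zero (w.adicCompletion F) _ ha0 h
  have hlog := dvd_log_valued_of_dvd_ord F w ha0 hdvd
  rwa [show Valued.v (algebraMap F (w.adicCompletion F) (a : F)) = w.valuation F (a : F) from
    HeightOneSpectrum.valuedAdicCompletion_eq_valuation' w (a : F)] at hlog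

/-- The same with the local Kummer class in the `kummerMap` dialect (`n` is invertible in `F_w`, characteristic `0`).
[cite: SerreLocalFields1979, XIV §1 Prop. 3] -/
theorem dvd_log_valuation_of_forall_unramified_cupProduct_kummerMap_eq_zero (a : Fˣ)
    (h : haveI : CompactSpace (absoluteGaloisGroup (w.adicCompletion F)) :=
        absoluteGaloisGroup_compactSpace (w.adicCompletion F)
      haveI : NeZero ((n : ℕ) : w.adicCompletion F) :=
        ⟨by haveI : CharZero (w.adicCompletion F) := charZero_adicCompletion w; exact_mod_cast NeZero.ne n⟩
      ∀ θ : CyclicCharacter (absoluteGaloisGroup (w.adicCompletion F)) n,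
        (∀ σ ∈ absInertia (w.adicCompletion F), θ σ = 0) →
        ((mu (w.adicCompletion F) n).tateDualPairing n).cupProduct
          (Multiplicative.toAdd (kummerMap (w.adicCompletion F) n
            (Units.map (algebraMap F (w.adicCompletion F) : F →* w.adicCompletion F) a)))
          (oneCocycleClass _ (scalarCocycle θ)) = 0) :
    (n : ℤ) ∣ WithZero.log (w.valuation F (a : F)) := by
  haveI : CharZero (w.adicCompletion F) := charZero_adicCompletion w
  haveI : NeZero ((n : ℕ) : w.adicCompletion F) := ⟨by exact_mod_cast NeZero.ne n⟩
  have hdvd := (forall_unramified_cupProduct_kummerMap_eq_zero_iff_dvd_ord (w.adicCompletion F)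
    (Units.map (algebraMap F (w.adicCompletion F) : F →* w.adicCompletion F) a)).mp h
  have ha0 : algebraMap F (w.adicCompletion F) (a : F) ≠ 0 :=
    (map_ne_zero_iff _ (algebraMap F (w.adicCompletion F)).injective).2 a.ne_zero
  have hlog := dvd_log_valued_of_dvd_ord F w ha0 hdvd
  rwa [show Valued.v (algebraMap F (w.adicCompletion F) (a : F)) = w.valuation F (a : F) from
    HeightOneSpectrum.valuedAdicCompletion_eq_valuation' w (a : F)] at hlog

/-- **Dictionary: the Poitou–Tate localisation of the global Kummer class is the local Kummer class.** Along
`μ_n(F̄)|_{Γ_{F_w}} ≅ μ_n(F̄_w)` (`muLocalIso w n`), `loc_w (kummerMap F n a) ↦ kummerMap F_w n a`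
(`cohomologyMap_muLocalIso_localization` + `resMu_δ₀_baseUnitsInvariant` + §0). This is the rewrite by which a consumer
holding the orthogonality for THE canonical family (`LocalInvariants.canonical F n (Sum.inr w) = localInvariantMap F n w =
invLevel F_w n ∘ H²(muLocalIso)`, `localInvariantMap_apply`) reaches the local dialect of §1–§2. [cite: SerreGaloisCohomology1997, II §1.2] -/
theorem cohomologyMap_muLocalIso_localization_kummerMap [NeZero ((n : ℕ) : F)] (a : Fˣ) :
    haveI : NeZero ((n : ℕ) : w.adicCompletion F) :=
      ⟨by haveI : CharZero (w.adicCompletion F) := charZero_adicCompletion w; exact_mod_cast NeZero.ne n⟩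
    (cohomologyMap (muLocalIso w n).hom 1).hom
        (galoisCohomology.localization (mu F n) (Sum.inr w) 1 (Multiplicative.toAdd (kummerMap F n a))) =
      Multiplicative.toAdd (kummerMap (w.adicCompletion F) n
        (Units.map (algebraMap F (w.adicCompletion F) : F →* w.adicCompletion F) a)) := by
  haveI : CharZero (w.adicCompletion F) := charZero_adicCompletion w
  haveI : NeZero ((n : ℕ) : w.adicCompletion F) := ⟨by exact_mod_cast NeZero.ne n⟩
  have ha : Units.mk0 (a : F) a.ne_zero = a := Units.ext rfl
  have ha0 : algebraMap F (w.adicCompletion F) (a : F) ≠ 0 :=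
    (map_ne_zero_iff _ (algebraMap F (w.adicCompletion F)).injective).2 a.ne_zero
  have ha' : Units.mk0 (algebraMap F (w.adicCompletion F) (a : F)) ha0 =
      Units.map (algebraMap F (w.adicCompletion F) : F →* w.adicCompletion F) a := Units.ext rfl
  rw [cohomologyMap_muLocalIso_localization]
  have key := resMu_δ₀_baseUnitsInvariant (n := n) F (w.adicCompletion F) (a : F) a.ne_zero ha0
  rw [δ₀_baseUnitsInvariant_eq_toAdd_kummerMap F n,
    δ₀_baseUnitsInvariant_eq_toAdd_kummerMap (w.adicCompletion F) n, ha, ha'] at key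
  exact key

end Completion

end Summit.BirchSwinnertonDyer.BirchSwinnertonDyer.Theorems.PrintCf2.KummerProNull

end
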